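import Summits.QuantumFields.YangMills.Theorems.BalabanUVNodesK0PrintCubeOfStepTokensR
import Summits.QuantumFields.YangMills.Theses.BalabanUVNodes

/-!
# K0⁷ V19 — THE THREE REGISTERED STUB TEXTS AS TREE DEFINITIONS (so that stub proofs can be filed BY NAME), and the by-name composition

Cell `pub-ymgap`, width seat `pub-ymgap-k0-s2-w1` (g0; director-ym №197 ∕ HUMAN RULING D-0149).  `--kind definition --supports stmt-QuantumFields-20541 --as helper`.
[15] = [Balaban1985Variational]; [6] = [Balaban1985RegularSpaces]; [I] = [Balaban1987RG1]; [II] = [Balaban1989LargeFieldII]; [III] = [Balaban1988Convergent].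

WHY.  Plan g81 registered skeleton V19 on K0⁷ stmt-QuantumFields-20541 (`[YMPLAN-G81-K0V19-REGISTERED 87879403b3a26109]`, bus 2026-08-28 01:17Z; file
`HOME/pub-ymgap-plan/D81-K0V19/K0Skeleton13SepCoPHV19.lean`, ns `…Theses.BalabanUVNodes.K0Skeleton13SepCoPHV19`): stubs `stub_prop8StepCoP13 : ∀ F : T4Family, Prop8StepCoPAt F`,
`stub_prop6MemberB8AtP13 : ∀ F : T4Family, Prop6MemberB8AtP F`, `stub_absBetaBoxAtThm1WitnessCCMGen13 : ∀ F : T4Family, AbsBetaBoxAtThm1WitnessCCMGenAt F`; the gate credits a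
`--supports 20541` proof only if it proves a registered stub BY NAME with that VERBATIM header.  The three stub predicates are `def`s LOCAL to the skeleton file, which lives in the
plan's HOME folder and is never imported (the tree stays sorry-free) — so no tree file can spell `Prop6MemberB8AtP F`.  THIS FILE puts the three predicate texts (and the K0⁷ body
`K0HBodyAt`) into the tree BYTE-FOR-BYTE as in V19 (l.66–68, 72–74, 85–92, 106–107 of the registered file), for every stub lane to import: stub 1 = N07 ∕ k0-s1 seats, stub 2′ = N05
print-cube roads (this seat's `K0Stub2PrimeJunction` ∕ `K0Stub2OfSockGamma`, dag-n05-e's flat line γ, dag-n05-c's T4), stub 3ᴬ′ = NODE O.  §2 composes K0⁷ BY NAME from the three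
texts (dag-n21-c's (b3) PART 2 `record13SepCoPHBody_of_stubs1_2P_3A'`), exactly as the skeleton's `Record13SepCoPHInhabited_of` ∕ `k0SepCoPH_inhabited` do.

CONTENTS.  §1 `Prop8StepCoPAt`, `Prop6MemberB8AtP`, `AbsBetaBoxAtThm1WitnessCCMGenAt`, `K0HBodyAt` (V19 texts VERBATIM; docstrings = the skeleton's).  §2 `record13SepCoPHInhabited_iff`
(K0⁷ ⟺ `∀ F, K0HBodyAt F`, `Iff.rfl`), `record13SepCoPHInhabited_of_stubTexts` (the three texts ⟹ K0⁷ BY NAME).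

HONEST FRAMING.  Definitions and one by-name composition; NOTHING of Bałaban asserted; no stub is proved here; K0⁷ stmt-QuantumFields-20541 OPEN, unclaimed; the skeleton of record is the
plan's V19 (this file neither replaces nor re-registers it — it mirrors its texts so that proofs can be filed by name; if the plan re-cuts, this file is superseded, not edited).
Counts unmoved (typed 28∕28 · discharged 5∕27).  One finite 𝕋⁴ programme at fixed `ε = L^{−K}`, Bałaban AS PRINTED — NOT continuum ∕ ℝ⁴ ∕ OS ∕ mass gap ∕ Clay: the Yang–Mills
mass gap is NOT proved by any of this; route R4 closes the CONDITIONAL finite-𝕋⁴ rung `BalabanLadder.UV` only.  No `sorry`, `instance`, `notation`; standard axioms.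
-/

noncomputable section

open scoped Matrix.Norms.L2Operator

namespace Summit.QuantumFields.YangMills.Theorems.K0V19Defs

open Literature.MathematicalPhysics.QuantumFieldTheory.Balaban1983to89
open Literature.MathematicalPhysics.QuantumFieldTheory.Balaban1983to89.T4Continuum
open Literature.MathematicalPhysics.QuantumFieldTheory.Balaban1983to89.Node00
open Literature.MathematicalPhysics.QuantumFieldTheory.Balaban1983to89.FlowStep
open Literature.MathematicalPhysics.QuantumFieldTheory.Balaban1983to89.B8LeafModelZd (ZdIdx)
open Summit.QuantumFields.YangMills.Theorems.K0PrintCubeOfStepTokensR (record13SepCoPHBody_of_stubs1_2P_3A')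

/-! ## §1 The three registered V19 stub texts and the K0⁷ body, verbatim -/

/-- RUNG 1 text (V19 = V13∕V14 VERBATIM): [15] Proposition 8's top step for critical configurations of print's class (6) with (7)-data on def-R's support selector, at `N = 2`,
for SOME constants `(B₃, a₀, a₁)` with print's floor `2L² ≤ B₃` and `0 < a₀`, `0 < a₁` displayed.  (= the body of registered stub `stub_prop8StepCoP13`.)
[cite: Balaban1985Variational, (1) p.277, Thm 1 (2)–(8) pp.278–279, p.299, Prop. 8 p.304; Balaban1985RegularSpaces, (1.3)–(1.9) p.77; Balaban1988Convergent, (2.6)–(2.8) pp.255–256, (2.12) p.256] -/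
def Prop8StepCoPAt (F : T4Family) : Prop :=
  ∃ B₃ a₀ a₁ : ℝ, 2 * (F.L : ℝ) ^ 2 ≤ B₃ ∧ 0 < a₀ ∧ 0 < a₁ ∧
    Prop8RegSepTopStep F 2 (fun ν K Ω => suppDomOfRecord F ν K Ω) B₃ a₀ a₁

/-- RUNG 2′ text (V19; = dag-n21-c PART 2's `h2P` binder at one family, plan declarer word l.24860): N05's [6] Proposition 6 AT NODE 00's PRINT-CUBE member `zdCubP (MatA 2) F.L ρ₀` over
the whole index `ZdIdx 4 L`, for SOME bare multiplier `ρ₀ ≥ 1` (collar `ρ₀·L`) and SOME `B₁ ≥ 0`, `c₁ > 0` — the hypothesis `hP6` of dag-n07-e's 36c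
`gauge9RP_of_prop8TopStep_of_prop6P_of_one_le` at `N = 2`.  (= the body of registered stub `stub_prop6MemberB8AtP13`.)
[cite: Balaban1985RegularSpaces, Prop. 6 (1.135)–(1.138) p.99, p.98, Thm 4 p.88, Prop. 3 p.87; Balaban1985Variational, (144)–(152) pp.300–301] -/
def Prop6MemberB8AtP (F : T4Family) : Prop :=
  ∃ (ρ₀ : ℕ) (B₁ c₁ : ℝ), 1 ≤ ρ₀ ∧ 0 ≤ B₁ ∧ 0 < c₁ ∧
    (letI : CStarAlgebra (MatA 2) := {}; B8.Prop6Printed 4 (F.L : ℝ) B₁ c₁ (fun i : ZdIdx 4 F.L => zdCubP (MatA 2) F.L ρ₀ i))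

/-- RUNG 3ᴬ′ text (V19; = PART 1's `h3A'` binder of `record13SepCoPHBody_of_stub1_of_gauge9Supplier_of_absBetaBoxAt` at one family): 3ᴬ with the K0 witness numerics `(j, c)`
GENERIC — at every `(j, c)` with `c ≤ L^j` and every constants tuple where [15] Thm 1's regularity sentence and the floor-carrying (9)-step at `(L^j, c)` hold, some window `γ₀ > 0`,
thresholds `ε₀, ε₂₉ > 0` and a bound `β'` give `−β' ≤ β₁₃ ≤ β'` on every box `]0, γ₀]^(k+1)` for `β₁₃ = betaOfRecord₁₃ F 2 (theta13OfThm1CCM F 2 j ε₀ ε₂₉ B₃ B₃' a₀ a₁)`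
([I] §1 p.264 ∕ Thm 2 «uniformly bounded», proof unpublished [II] p.355; NO SIGN; window the prover's).  (= the body of registered stub `stub_absBetaBoxAtThm1WitnessCCMGen13`.)
[cite: Balaban1987RG1, Thm 1 p.255, Thm 2, (1.20)–(1.22) p.264, §1 p.264; Balaban1989LargeFieldII, p.355, (1.4) p.357; Balaban1988Convergent, (2.4) p.255, (2.10) p.256, Thm 1 p.262] -/
def AbsBetaBoxAtThm1WitnessCCMGenAt (F : T4Family) : Prop :=
  ∀ (j c : ℕ) (B₃ B₃' a₀ a₁ : ℝ), c ≤ F.L ^ j → 2 * (F.L : ℝ) ^ 2 ≤ B₃ → 0 < B₃' → 0 < a₀ → 0 < a₁ →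
    VariationalThm1RegSepCoP7M F 2 B₃ a₀ a₁ →
    Gauge9RegSepTopStepR F 2 (fun ν K Ω => suppDomOfRecord F ν K Ω) (F.L ^ j) c B₃ B₃' a₀ a₁ →
    ∃ γ₀ ε₀ ε₂₉ β' : ℝ, 0 < γ₀ ∧ 0 < ε₀ ∧ 0 < ε₂₉ ∧
      BetaLowerH (-β') γ₀ (betaOfRecord₁₃ F 2 (theta13OfThm1CCM F 2 j ε₀ ε₂₉ B₃ B₃' a₀ a₁)) ∧
      BetaUpperH β' γ₀ (betaOfRecord₁₃ F 2 (theta13OfThm1CCM F 2 j ε₀ ε₂₉ B₃ B₃' a₀ a₁))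

/-- THE K0⁷ BODY AT ONE FAMILY (V19 text; K0⁷ `Record13SepCoPHInhabited` is `∀ F, K0HBodyAt F` by `rfl`, §2). [cite: Balaban1988Convergent, Thm 1 p.262, (2.6)–(2.8) pp.255–256; Balaban1987RG1, Thm 1 p.259] -/
def K0HBodyAt (F : T4Family) : Prop :=
  ∃ θ : Stage13HParams F 2, θ.Provisos₁₃SepCoPH F 2 ∧ (θ.ZhUnity F 2 ∧ θ.SlotsNondegenerate₁₃ F 2) ∧ θ.Admissible F 2

/-! ## §2 K0⁷ by name from the three texts -/

/-- sanity (kernel): K0⁷ is literally `∀ F, K0HBodyAt F`. [cite: Balaban1988Convergent, Thm 1 p.262 (bookkeeping)] -/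
theorem record13SepCoPHInhabited_iff :
    Summit.QuantumFields.YangMills.Theses.BalabanUVNodes.Record13SepCoPHInhabited ↔ ∀ F : T4Family, K0HBodyAt F :=
  Iff.rfl

/-- **K0⁷ BY NAME FROM THE THREE V19 STUB TEXTS** — dag-n21-c's (b3) PART 2 `record13SepCoPHBody_of_stubs1_2P_3A'` (the three predicates unfold by `rfl` to its binders); the same
composition as the registered skeleton's `Record13SepCoPHInhabited_of` ∕ `k0SepCoPH_inhabited`.  CONDITIONAL on the three texts (stubs 1 ∕ 2′ ∕ 3ᴬ′ — not proved here); K0⁷ OPEN.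
[cite: Balaban1985Variational, Thm 1 (8)–(9) p.279, Prop. 8 p.304; Balaban1985RegularSpaces, Prop. 6 p.99, p.98; Balaban1988Convergent, Thm 1 p.262; Balaban1987RG1, Thm 1 p.259, §1 p.264] -/
theorem record13SepCoPHInhabited_of_stubTexts (h1 : ∀ F : T4Family, Prop8StepCoPAt F) (h2P : ∀ F : T4Family, Prop6MemberB8AtP F)
    (h3A' : ∀ F : T4Family, AbsBetaBoxAtThm1WitnessCCMGenAt F) :
    Summit.QuantumFields.YangMills.Theses.BalabanUVNodes.Record13SepCoPHInhabited :=
  record13SepCoPHBody_of_stubs1_2P_3A' h1 h2P h3A'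

end Summit.QuantumFields.YangMills.Theorems.K0V19Defs

end
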